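import Literature.AlgebraicGeometry.Motives.HodgeStructureLefschetzGroupCenterFiniteIff
import HarnessLib

/-!
# MILNE'S `S₀(A)(R) = {γ ∈ C₀(A) ⊗_ℚ R | γ†γ = 1}` IS THE CENTRE OF `S(A)(R)` — ON `K`-POINTS, FOR EVERY FIELD `K ⊇ ℚ`:
# `γ ↦ ↑γ` is a bijection `Z(S(H)(K)) → {a ∈ Z(E_φ) ⊗ K | a^{†_K} a = 1}`; `γ ↦ γ_K` embeds `Z(S(H)(ℚ))` in `Z(S(H)(K))`;
# a Rosati involution of the second kind on `C₀` makes `Z(S(H)(K))` infinite for EVERY `K`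
# (Milne 1999 §1 p. 645, Prop. 1.7, Remark 1.6; Moonen–Zarhin 1998 §1 Lemma (1))

[topic AlgebraicGeometry/Motives]

Layer `Literature/AlgebraicGeometry/Motives`, lane `lit-hodgefound` (Track 2 foundations library; prover seat
`lit-hodgefound-p02`, generation 54, self-proposed row g54-#10). THEOREMS ONLY: no definition, no named fact (net debt `0`),
no instance, no notation.  `K`-points companion of g54-#8 §1 (`Motives/HodgeStructureLefschetzGroupCenterFinite`: over `ℚ`,
`γ ↦ ↑γ` is a bijection `Z(S(H)(ℚ)) → S₀(ℚ) = {z ∈ Z(E_φ) | z† z = 1}`) and of g54-#9 (`…CenterFiniteIff`: second kind ⟹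
`Z(S(H)(ℚ))` infinite).  Milne defines `S₀(A)` through its points in every commutative `ℚ`-algebra `R`,
`S₀(A)(R) = {γ ∈ C₀(A) ⊗_ℚ R | γ†γ = 1}` (p. 645 L8–L10), and `S(A)(R) = {γ ∈ C(A) ⊗ R | γ†γ = 1}` (p. 644 L16–L18); here
`R = K` is a field containing `ℚ`, `C₀ ⊗ K` is the `K`-span of the `z_K`, `z ∈ Z(E_φ) = E_φ ∩ C(H)` inside `End_K(K ⊗ V)` (the
tree's `toSubmodule_map_val_center_centralizer_endAlg_baseChange_eq_span`: it IS the centre of `C(H)(K)`), and `†_K` is Milne's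
`K`-linear adjoint `ψ.adjointBaseChange K` (`Motives/HodgeStructurePolarizationAdjointPoints`).  What is proved: (i) every
`a ∈ C₀ ⊗ K` with `a^{†_K} a = 1` is `↑γ` for a (unique) central `γ ∈ S(H)(K)` (it is a unit of the finite-dimensional
`End_K(K ⊗ V)`, lies in `C(H) ⊗ K`, preserves `ψ_K`, and is central by g54-#4
`Polarization.mem_center_lefschetzGroupBaseChange_iff_mem_span_center`), so `γ ↦ ↑γ` is a BIJECTION `Z(S(H)(K)) → S₀(K)`;
(ii) `γ ↦ γ_K = 1 ⊗ γ` (the tree's `glBaseChange`, Remark 1.6 «`S'(A) ≅ S(A)_{/k'}`» on points) maps `Z(S(H)(ℚ))` injectively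
into `Z(S(H)(K))`; (iii) hence if `†` moves a central element of `E_φ` (second kind; a factor of type IV), or if the centre is a
CM field, then `Z(S(H)(K))` is infinite for EVERY field `K ⊇ ℚ`, and a finite `Z(S(H)(K))` for some `K` forces `†` to be of the
first kind on `C₀`.

## The sources, verbatim

* J. S. Milne, *Lefschetz classes on abelian varieties*, Duke Math. J. 96 (1999) 639–675 [Milne1999LefschetzClasses] (held
  `paper:doi-10-1215-s0012-7094-99-09620-5`, folios 6–7): p. 644 L16–L18 "`S(A)` […] such that, for all commutative
  `k`-algebras `R`, `S(A)(R) = {γ ∈ C(A) ⊗_k R | γ†γ = 1}`"; p. 644 Remark 1.6 "`C′(A) ≅ C(A) ⊗_k k′`, and therefore `S′(A) ≅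
  S(A)_{/k′}`"; p. 645 L8–L14 "Define `S₀(A)` to be the algebraic group over `ℚ` such that, for all commutative `ℚ`-algebras
  `R`, `S₀(A)(R) = {γ ∈ C₀(A) ⊗_ℚ R | γ†γ = 1}`. Proposition 1.7. The action of `End⁰(A)` on `V(A)` induces an isomorphism
  `C₀(A) ⊗_ℚ ℚ_ℓ → C(A)` of `ℚ_ℓ`-algebras with involution, and hence an isomorphism of algebraic groups `S₀(A)_{/ℚ_ℓ} → S(A)`."
* B. J. J. Moonen, Yu. G. Zarhin, *Weil classes on abelian varieties*, J. reine angew. Math. 496 (1998) 83–92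
  [MoonenZarhin1998WeilClasses] (held `paper:arxiv-alg-geom_9612017`, chunk p0002 L121–L127): «(1) The center of `G_div(X)` is the
  group `U_{K_B}` given by `U_{K_B}(R) = {a ∈ (K_B ⊗_ℚ R)^* ∣ a a† = 1}`. For `X` of type 4 […] a connected torus of rank `e₀`; in
  all other cases it is finite.»
* N. Bourbaki, *Algebra I* (1989) [BourbakiAlgebraI1989], Ch. II §5 no. 3 Prop. 7 (ii) (`a ↦ a_K` is injective).

## Dictionary and what is proved (namespace `Literature.AlgebraicGeometry.Motives.HodgeStructure`)

`S(H)(K) = ψ.lefschetzGroupBaseChange K ≤ GL_K(K ⊗ V)`, `C₀ ⊗ K = span_K {z_K | z ∈ E_φ ⊓ C(H)}`, `†_K = ψ.adjointBaseChange K`,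
`γ_K = glBaseChange K V γ`.

* §1 **`Polarization.exists_mem_center_lefschetzGroupBaseChange_coe_eq`** (`a ∈ C₀ ⊗ K`, `a^{†_K} a = 1` ⟹ `a = ↑γ`, `γ`
  central in `S(H)(K)`), **`Polarization.bijOn_coe_center_lefschetzGroupBaseChange`** (`Z(S(H)(K)) ≅ S₀(K)`).
* §2 `Polarization.glBaseChange_mem_center_lefschetzGroupBaseChange` (`γ` central in `S(H)(ℚ)` ⟹ `γ_K` central in `S(H)(K)`),
  **`Polarization.exists_center_lefschetzGroup_to_center_lefschetzGroupBaseChange_injective`** (an injective map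
  `Z(S(H)(ℚ)) → Z(S(H)(K))` over `γ ↦ γ_K`), `Polarization.infinite_center_lefschetzGroupBaseChange_of_infinite`.
* §3 **`Polarization.infinite_center_lefschetzGroupBaseChange_of_adjoint_ne`** (second kind ⟹ `Z(S(H)(K))` infinite for every
  `K`), `Polarization.infinite_center_lefschetzGroupBaseChange_of_isCMField` (CM centre),
  `Polarization.adjoint_eq_self_of_finite_center_lefschetzGroupBaseChange` (a finite `Z(S(H)(K))` forces the first kind).
-/

noncomputable section

open scoped TensorProduct

open NumberField

namespace Literature.AlgebraicGeometry.Motives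

namespace HodgeStructure

universe u uK

variable (K : Type uK) [Field K] [Algebra ℚ K] {V : Type u} [AddCommGroup V] [Module ℚ V] [Module.Finite ℚ V] {n : ℤ}
  {H : HodgeStructure V n} (ψ : Polarization H)

/-! ## §1 `S₀(K) = Z(S(H)(K))`: every `a ∈ C₀ ⊗ K` with `a^{†_K} a = 1` is a central element of `S(H)(K)` -/

/-- **EVERY `a ∈ C₀ ⊗ K` WITH `a^{†_K} a = 1` IS A CENTRAL ELEMENT OF `S(H)(K)`**: `a` is a unit of the finite-dimensional
`End_K(K ⊗ V)` (`a† a = 1`), it lies in `C(H) ⊗ K ⊇ C₀ ⊗ K` and satisfies `a†a = 1`, so it belongs to `S(H)(K)` (the tree's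
`Polarization.mem_lefschetzGroupBaseChange_iff_mem_span_and_adjointBaseChange_mul_self_eq_one` — Milne's definition of
`S(A)(R)`), and it is central because it lies in `C₀ ⊗ K` (g54-#4). The surjectivity half of «`S₀(A)_{/K} ≅` the centre» on
`K`-points. [cite: Milne1999LefschetzClasses, §1 p. 644 L16–L18 and p. 645 L8–L14 (S₀, Prop. 1.7)] -/
theorem Polarization.exists_mem_center_lefschetzGroupBaseChange_coe_eq {a : Module.End K (K ⊗[ℚ] V)}
    (ha : a ∈ Submodule.span K ((fun z : Module.End ℚ V => z.baseChange K) ''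
      ((H.endAlg ⊓ Subalgebra.centralizer ℚ (H.endAlg : Set (Module.End ℚ V)) :
        Subalgebra ℚ (Module.End ℚ V)) : Set (Module.End ℚ V))))
    (hunit : ψ.adjointBaseChange K a * a = 1) :
    ∃ γ : ψ.lefschetzGroupBaseChange K, γ ∈ Subgroup.center (ψ.lefschetzGroupBaseChange K) ∧
      ((γ : (K ⊗[ℚ] V) ≃ₗ[K] (K ⊗[ℚ] V)) : Module.End K (K ⊗[ℚ] V)) = a := by
  have h12 : a * ψ.adjointBaseChange K a = 1 := mul_eq_one_symm hunit
  have hU : IsUnit a := ⟨⟨a, _, h12, hunit⟩, rfl⟩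
  obtain ⟨γ₀, hγ₀⟩ : ∃ γ₀ : (K ⊗[ℚ] V) ≃ₗ[K] (K ⊗[ℚ] V), (γ₀ : Module.End K (K ⊗[ℚ] V)) = a :=
    ⟨LinearMap.GeneralLinearGroup.generalLinearEquiv K (K ⊗[ℚ] V) hU.unit, by
      rw [LinearMap.GeneralLinearGroup.generalLinearEquiv_to_linearMap, IsUnit.unit_spec]⟩
  have hspanC : a ∈ Submodule.span K ((fun c : Module.End ℚ V => c.baseChange K) ''
      (Subalgebra.centralizer ℚ (H.endAlg : Set (Module.End ℚ V)) : Set (Module.End ℚ V))) :=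
    Submodule.span_mono (Set.image_mono fun z hz => (Algebra.mem_inf.1 hz).2) ha
  have hmem : γ₀ ∈ ψ.lefschetzGroupBaseChange K := by
    rw [ψ.mem_lefschetzGroupBaseChange_iff_mem_span_and_adjointBaseChange_mul_self_eq_one K, hγ₀]
    exact ⟨hspanC, hunit⟩
  refine ⟨⟨γ₀, hmem⟩, (ψ.mem_center_lefschetzGroupBaseChange_iff_mem_span_center K ⟨γ₀, hmem⟩).2 ?_, hγ₀⟩
  change (γ₀ : Module.End K (K ⊗[ℚ] V)) ∈ _
  rw [hγ₀]
  exact ha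

/-- **`Z(S(H)(K)) ≅ S₀(K) = {a ∈ C₀ ⊗ K | a^{†_K} a = 1}`** for every field `K ⊇ ℚ`: `γ ↦ ↑γ` is a bijection from the centre of
`S(H)(K)` onto the set of `K`-endomorphisms of `K ⊗ V` in the `K`-span of `Z(E_φ)` with `a† a = 1` (into: g54-#4 and Milne's
`γ†γ = 1`; onto: §1) — «`S₀(A)_{/ℚ_ℓ} → S(A)` is an isomorphism onto the centre», on `K`-points.
[cite: Milne1999LefschetzClasses, §1 p. 645 L8–L14 (S₀, Prop. 1.7) and Remark 1.6] [cite: MoonenZarhin1998WeilClasses, §1 Lemma (1)] -/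
theorem Polarization.bijOn_coe_center_lefschetzGroupBaseChange :
    Set.BijOn (fun γ : ψ.lefschetzGroupBaseChange K => ((γ : (K ⊗[ℚ] V) ≃ₗ[K] (K ⊗[ℚ] V)) : Module.End K (K ⊗[ℚ] V)))
      (Subgroup.center (ψ.lefschetzGroupBaseChange K) : Set (ψ.lefschetzGroupBaseChange K))
      {a : Module.End K (K ⊗[ℚ] V) |
        a ∈ Submodule.span K ((fun z : Module.End ℚ V => z.baseChange K) ''
          ((H.endAlg ⊓ Subalgebra.centralizer ℚ (H.endAlg : Set (Module.End ℚ V)) :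
            Subalgebra ℚ (Module.End ℚ V)) : Set (Module.End ℚ V))) ∧
        ψ.adjointBaseChange K a * a = 1} := by
  refine ⟨?_, ?_, ?_⟩
  · intro γ hγ
    exact ⟨(ψ.mem_center_lefschetzGroupBaseChange_iff_mem_span_center K γ).1 hγ,
      ((ψ.mem_lefschetzGroupBaseChange_iff_adjointBaseChange_mul_self_eq_one K _).1 γ.2).2⟩
  · intro γ _ γ' _ h
    exact Subtype.ext (LinearEquiv.toLinearMap_injective h)
  · intro a ha
    obtain ⟨γ, hγ, hγa⟩ := ψ.exists_mem_center_lefschetzGroupBaseChange_coe_eq K ha.1 ha.2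
    exact ⟨γ, hγ, hγa⟩

/-! ## §2 `γ ↦ γ_K` embeds `Z(S(H)(ℚ))` in `Z(S(H)(K))` -/

omit [Module.Finite ℚ V] in
/-- `g ↦ g_K = 1 ⊗ g : GL(V) → GL_K(K ⊗ V)` is injective (`a ↦ a_K` is injective on `End`; private copy of the tree's
`glBaseChange_injective`, `Motives/HodgeGroupCommutativeIffCMPoints`). [cite: BourbakiAlgebraI1989, Ch. II §5 no. 3 Prop. 7 (ii)] -/
private theorem glBaseChange_injective₅₄₁₀ : Function.Injective (glBaseChange K V) := fun g g' h => by
  haveI : Module.Free ℚ V := Module.Free.of_divisionRing ℚ V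
  apply LinearEquiv.toLinearMap_injective
  apply LinearMap.baseChangeHom_injective (R := ℚ) (S := K) (M := V) (N := V)
  rw [LinearMap.baseChangeHom_apply, LinearMap.baseChangeHom_apply, ← LinearEquiv.coe_baseChange,
    ← LinearEquiv.coe_baseChange, ← glBaseChange_apply, ← glBaseChange_apply, h]

omit [Module.Finite ℚ V] in
/-- `γ ∈ S(H)(ℚ) ⟹ γ_K ∈ S(H)(K)` (the tree's `Polarization.lefschetzGroup_le_comap_lefschetzGroupBaseChange`, membership form).
[cite: Milne1999LefschetzClasses, §1 Remark 1.6 (p. 644)] -/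
private theorem Polarization.glBaseChange_mem₅₄₁₀ (γ : ψ.lefschetzGroup) :
    glBaseChange K V (γ : V ≃ₗ[ℚ] V) ∈ ψ.lefschetzGroupBaseChange K :=
  Subgroup.mem_comap.1 (ψ.lefschetzGroup_le_comap_lefschetzGroupBaseChange K γ.2)

/-- **A CENTRAL `γ ∈ S(H)(ℚ)` STAYS CENTRAL IN `S(H)(K)`**: `γ_K = 1 ⊗ γ ∈ S(H)(K)` (the tree's
`Polarization.lefschetzGroup_le_comap_lefschetzGroupBaseChange`, Remark 1.6 on points) and `↑(γ_K) = (↑γ)_K` with `↑γ ∈ Z(E_φ)`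
(g54-#4 `Polarization.mem_center_lefschetzGroup_iff`, `Polarization.baseChange_mem_center_lefschetzGroupBaseChange`).
[cite: Milne1999LefschetzClasses, §1 Remark 1.6 (p. 644) and p. 645 L8–L14] -/
theorem Polarization.glBaseChange_mem_center_lefschetzGroupBaseChange {γ : ψ.lefschetzGroup}
    (hγ : γ ∈ Subgroup.center ψ.lefschetzGroup) :
    (⟨glBaseChange K V (γ : V ≃ₗ[ℚ] V), ψ.glBaseChange_mem₅₄₁₀ K γ⟩ : ψ.lefschetzGroupBaseChange K) ∈
      Subgroup.center (ψ.lefschetzGroupBaseChange K) := by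
  refine ψ.baseChange_mem_center_lefschetzGroupBaseChange K ((ψ.mem_center_lefschetzGroup_iff γ).1 hγ) ?_
  show ((glBaseChange K V (γ : V ≃ₗ[ℚ] V) : (K ⊗[ℚ] V) ≃ₗ[K] (K ⊗[ℚ] V)) : Module.End K (K ⊗[ℚ] V)) =
    (((γ : V ≃ₗ[ℚ] V) : Module.End ℚ V)).baseChange K
  rw [glBaseChange_apply, LinearEquiv.coe_baseChange]

/-- **`Z(S(H)(ℚ)) ↪ Z(S(H)(K))` OVER `γ ↦ γ_K`**: there is an injective map from the centre of `S(H)(ℚ)` to the centre of `S(H)(K)`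
whose underlying automorphism of `K ⊗ V` is `γ_K = 1 ⊗ γ` («`S′(A) ≅ S(A)_{/k′}`» on points; `g ↦ g_K` is injective).
[cite: Milne1999LefschetzClasses, §1 Remark 1.6 (p. 644)] [cite: BourbakiAlgebraI1989, Ch. II §5 no. 3 Prop. 7 (ii)] -/
theorem Polarization.exists_center_lefschetzGroup_to_center_lefschetzGroupBaseChange_injective :
    ∃ f : Subgroup.center ψ.lefschetzGroup → Subgroup.center (ψ.lefschetzGroupBaseChange K), Function.Injective f ∧
      ∀ γ : Subgroup.center ψ.lefschetzGroup,
        (((f γ : Subgroup.center (ψ.lefschetzGroupBaseChange K)) : ψ.lefschetzGroupBaseChange K) :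
            (K ⊗[ℚ] V) ≃ₗ[K] (K ⊗[ℚ] V)) = glBaseChange K V ((γ : ψ.lefschetzGroup) : V ≃ₗ[ℚ] V) := by
  refine ⟨fun γ => ⟨⟨glBaseChange K V ((γ : ψ.lefschetzGroup) : V ≃ₗ[ℚ] V), ψ.glBaseChange_mem₅₄₁₀ K γ⟩,
      ψ.glBaseChange_mem_center_lefschetzGroupBaseChange K γ.2⟩, fun γ γ' h => ?_, fun γ => rfl⟩
  have h1 : glBaseChange K V ((γ : ψ.lefschetzGroup) : V ≃ₗ[ℚ] V) =
      glBaseChange K V ((γ' : ψ.lefschetzGroup) : V ≃ₗ[ℚ] V) :=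
    congrArg (fun x : Subgroup.center (ψ.lefschetzGroupBaseChange K) =>
      ((x : ψ.lefschetzGroupBaseChange K) : (K ⊗[ℚ] V) ≃ₗ[K] (K ⊗[ℚ] V))) h
  exact Subtype.ext (Subtype.ext (glBaseChange_injective₅₄₁₀ K h1))

/-- **`Z(S(H)(ℚ))` INFINITE ⟹ `Z(S(H)(K))` INFINITE** for every field `K ⊇ ℚ`. [cite: Milne1999LefschetzClasses, §1 Remark 1.6 (p. 644)] -/
theorem Polarization.infinite_center_lefschetzGroupBaseChange_of_infinite [Infinite (Subgroup.center ψ.lefschetzGroup)] :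
    Infinite (Subgroup.center (ψ.lefschetzGroupBaseChange K)) := by
  obtain ⟨f, hf, -⟩ := ψ.exists_center_lefschetzGroup_to_center_lefschetzGroupBaseChange_injective K
  exact Infinite.of_injective f hf

/-! ## §3 Second kind on `C₀` ⟹ `Z(S(H)(K))` is infinite for every `K`; a finite `Z(S(H)(K))` forces the first kind -/

/-- **A ROSATI INVOLUTION OF THE SECOND KIND ON `C₀` MAKES `Z(S(A)(K))` INFINITE FOR EVERY FIELD `K ⊇ ℚ`** («For `X` of type 4
[…] a connected torus of rank `e₀`»: a positive-dimensional central torus has infinitely many points over every field of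
characteristic `0`; here via the `ℚ`-points of g54-#9 and §2). [cite: MoonenZarhin1998WeilClasses, §1 Lemma (1)]
[cite: Milne1999LefschetzClasses, §1 Remark 1.6 and §2 Summary p. 652] -/
theorem Polarization.infinite_center_lefschetzGroupBaseChange_of_adjoint_ne {z₀ : H.endAlg}
    (hz₀ : z₀ ∈ Subalgebra.center ℚ H.endAlg) (hne : ψ.adjoint (z₀ : Module.End ℚ V) ≠ z₀) :
    Infinite (Subgroup.center (ψ.lefschetzGroupBaseChange K)) := by
  haveI := ψ.infinite_center_lefschetzGroup_of_adjoint_ne hz₀ hne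
  exact ψ.infinite_center_lefschetzGroupBaseChange_of_infinite K

/-- **A CM CENTRE MAKES `Z(S(A)(K))` INFINITE FOR EVERY FIELD `K ⊇ ℚ`** (type IV). [cite: MoonenZarhin1998WeilClasses, §1 Lemma (1)]
[cite: Milne1999LefschetzClasses, §2 p. 646 L10–L16 and Summary p. 652] -/
theorem Polarization.infinite_center_lefschetzGroupBaseChange_of_isCMField {F : Type*} [Field F] [NumberField F] [IsCMField F]
    (g : F ≃+* Subring.center H.endAlg) : Infinite (Subgroup.center (ψ.lefschetzGroupBaseChange K)) := by
  haveI := ψ.infinite_center_lefschetzGroup_of_isCMField g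
  exact ψ.infinite_center_lefschetzGroupBaseChange_of_infinite K

/-- **A FINITE `Z(S(A)(K))` FOR SOME FIELD `K ⊇ ℚ` FORCES `†` TO BE OF THE FIRST KIND ON `C₀`** (types I–III).
[cite: MoonenZarhin1998WeilClasses, §1 Lemma (1)] [cite: Milne1999LefschetzClasses, §2 Summary p. 652]
[cite: Lange2023AbelianVarietiesComplex, §2.6.2 Lemma 2.6.4] -/
theorem Polarization.adjoint_eq_self_of_finite_center_lefschetzGroupBaseChange
    [Finite (Subgroup.center (ψ.lefschetzGroupBaseChange K))] {z : H.endAlg} (hz : z ∈ Subalgebra.center ℚ H.endAlg) :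
    ψ.adjoint (z : Module.End ℚ V) = z := by
  by_contra hne
  haveI := ψ.infinite_center_lefschetzGroupBaseChange_of_adjoint_ne K hz hne
  exact not_finite (Subgroup.center (ψ.lefschetzGroupBaseChange K))

end HodgeStructure

end Literature.AlgebraicGeometry.Motives
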